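import Literature.Computability.Complexity.RandomizedModularZeroTest
import HarnessLib

/-!
# The randomised modular zero test, height form: a VALUE bound instead of a coefficient bound

Companion of `RandomizedModularZeroTest.lean` (Schwartz 1980; Ibarra–Moran 1983; Arora–Barak 2009,
Lemma 7.5 + §7.2.3). There the height of the tested polynomials `Q_w` is controlled through
`Σ|coeff| ≤ 2^{2^{h(n)}}`; devices such as arithmetic circuits come with a bound on their VALUES
instead (`|Q_w(a)| ≤ 2^{2^{h(n)} (B+1)}` at points with coordinates of absolute value `< 2^B`:
`CircuitCode.natAbs_eval_semPoly_le`). This file runs the same one-trial analysis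
(`ModularZeroTest.uniformProb_witness_ge`) with parameters adapted to that hypothesis:

* `kOfH = h + 2d + 8` (point block length), `KOfH = 4h + 4d + 26` (modulus length), `coinPolyH`,
  `gapPolyH` (`+ 1 = 4 KOfH`);
* **`mem_coRP_of_modularZeroTest_height`**, `mem_BPP_of_modularZeroTest_height`: `{w | Q_w = 0} ∈ coRP`
  (resp. `BPP`) given the degree bound `deg Q_w ≤ 2^{d(n)}`, the value bound above, and a one-bit
  `FP` evaluator of `Q_w` modulo the random `KOfH(n)`-bit number at the random point.

## References

* J. T. Schwartz, J. ACM 27 (1980), Cor. 1 and §3 [Schwartz1980]; O. H. Ibarra, S. Moran, J. ACM 30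
  (1983), §4 [IbarraMoran1983]; S. Arora, B. Barak, *Computational Complexity*, CUP 2009, Lemma 7.5,
  §7.2.3 [AroraBarakCC2009].
-/

noncomputable section

namespace Literature.Computability.Complexity

open _root_.Computability Polynomial Finset

namespace ModularZeroTest

section Params

variable (v d h : Polynomial ℕ)

/-- Block length of a point coordinate, height form: `k(n) = h(n) + 2 d(n) + 8`. [folklore] -/
def kOfH (n : ℕ) : ℕ := h.eval n + 2 * d.eval n + 8

/-- Exponent of the height bound, height form: `t(n) = 2 h(n) + 2 d(n) + 8` (`≥ h + k`). [folklore] -/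
def tOfH (n : ℕ) : ℕ := 2 * h.eval n + 2 * d.eval n + 8

/-- Bit length of the modulus, height form: `K(n) = 4 h(n) + 4 d(n) + 26 = 2 t(n) + 10`. [folklore] -/
def KOfH (n : ℕ) : ℕ := 4 * h.eval n + 4 * d.eval n + 26

/-- The coin polynomial, height form: `K(n) + v(n) k(n)`. [cite: AroraBarakCC2009, Lemma 7.5 and §7.2.3] -/
def coinPolyH : Polynomial ℕ :=
  (Polynomial.C 4 * h + Polynomial.C 4 * d + Polynomial.C 26) + v * (h + Polynomial.C 2 * d + Polynomial.C 8)

/-- The gap polynomial, height form: `gapPolyH(n) + 1 = 4 K(n)`. [folklore] -/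
def gapPolyH : Polynomial ℕ := Polynomial.C 16 * h + Polynomial.C 16 * d + Polynomial.C 103

variable {v d h}

/-- Value of the coin polynomial (height form). [cite: AroraBarakCC2009, Lemma 7.5 and §7.2.3] -/
theorem eval_coinPolyH (n : ℕ) : (coinPolyH v d h).eval n = KOfH d h n + v.eval n * kOfH d h n := by
  simp [coinPolyH, KOfH, kOfH]

/-- Value of the gap polynomial (height form). [cite: AroraBarakCC2009, §7.4.1 (the success constant of RP is immaterial)] -/
theorem eval_gapPolyH_add_one (n : ℕ) : (gapPolyH d h).eval n + 1 = 4 * KOfH d h n := by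
  simp [gapPolyH, KOfH]; ring

/-- `K(n) = 2 t(n) + 10`. [folklore] -/
private theorem KOfH_eq (n : ℕ) : KOfH d h n = 2 * tOfH d h n + 10 := by
  simp [KOfH, tOfH]; ring

/-- `32 x + 224 ≤ 2^(x+8)`. [folklore] -/
private theorem lin_le_two_pow_add_eight' (x : ℕ) : 32 * x + 224 ≤ 2 ^ (x + 8) := by
  induction x with
  | zero => norm_num
  | succ x ih => rw [show x + 1 + 8 = (x + 8) + 1 by ring, pow_succ]; omega

/-- `2 t + 10 ≤ 2^(t+4)`. [folklore] -/
private theorem lin_le_two_pow_add_four' (t : ℕ) : 2 * t + 10 ≤ 2 ^ (t + 4) := by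
  induction t with
  | zero => norm_num
  | succ t ih => rw [show t + 1 + 4 = (t + 4) + 1 by ring, pow_succ]; omega

/-- First numeric fact (height form): `8 K · 2^d ≤ 2^k`. [folklore] -/
private theorem eight_K_two_pow_d_le' (n : ℕ) : 8 * KOfH d h n * 2 ^ d.eval n ≤ 2 ^ kOfH d h n := by
  have h1 := lin_le_two_pow_add_eight' (h.eval n + d.eval n)
  have h2 : 8 * KOfH d h n ≤ 2 ^ (h.eval n + d.eval n + 8) := by
    refine le_trans ?_ h1
    simp [KOfH]; omega
  calc 8 * KOfH d h n * 2 ^ d.eval n ≤ 2 ^ (h.eval n + d.eval n + 8) * 2 ^ d.eval n :=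
        Nat.mul_le_mul_right _ h2
    _ = 2 ^ kOfH d h n := by rw [← pow_add, kOfH]; congr 1; ring

/-- Second numeric fact (height form): `8 K (2^t + 2) ≤ 2^K`. [folklore] -/
private theorem eight_K_height_le' (n : ℕ) : 8 * KOfH d h n * (2 ^ tOfH d h n + 2) ≤ 2 ^ KOfH d h n := by
  set t := tOfH d h n with ht
  have h1 : KOfH d h n ≤ 2 ^ (t + 4) := by rw [KOfH_eq]; exact lin_le_two_pow_add_four' t
  have h2 : 2 ^ t + 2 ≤ 2 ^ (t + 2) := by
    rw [pow_add]; have := Nat.one_le_two_pow (n := t); omega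
  calc 8 * KOfH d h n * (2 ^ t + 2) ≤ 8 * 2 ^ (t + 4) * 2 ^ (t + 2) :=
        Nat.mul_le_mul (Nat.mul_le_mul_left 8 h1) h2
    _ = 2 ^ (2 * t + 9) := by
        rw [show (8 : ℕ) = 2 ^ 3 by norm_num, ← pow_add, ← pow_add]; congr 1; ring
    _ ≤ 2 ^ KOfH d h n := Nat.pow_le_pow_right (by norm_num) (by rw [KOfH_eq]; omega)

/-- The height exponent (height form): `2^h (k + 1) ≤ 2^t`. [folklore] -/
private theorem height_exponent_le' (n : ℕ) : 2 ^ h.eval n * (kOfH d h n + 1) ≤ 2 ^ tOfH d h n := by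
  have hk : kOfH d h n + 1 ≤ 2 ^ kOfH d h n := Nat.lt_two_pow_self
  have ht : tOfH d h n = h.eval n + kOfH d h n := by simp [tOfH, kOfH]; ring
  rw [ht, pow_add]
  exact Nat.mul_le_mul_left _ hk

end Params

section Main

variable {v d h : Polynomial ℕ}

/-- The point segment of the coins (height form): drop the `KOfH(n)` modulus bits. [folklore] -/
def pointSegH (d h : Polynomial ℕ) (n : ℕ) (y : List Bool) : List Bool := y.drop (KOfH d h n)

/-- **The randomised modular zero test, height form: `{w | sem w = 0} ∈ coRP`** (Schwartz 1980, Cor. 1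
and §3; Ibarra–Moran 1983, §4; Arora–Barak 2009, Lemma 7.5 with §7.2.3). As
`mem_coRP_of_modularZeroTest`, with the coefficient bound replaced by the value bound
`|Q_w(a)| ≤ 2^{2^{h(n)}(B+1)}` at integer points with `|a_i| < 2^B` (the form delivered by succinct
devices, e.g. `CircuitCode.natAbs_eval_semPoly_le`), and the parameters `kOfH`, `KOfH`, `coinPolyH`.
[cite: AroraBarakCC2009, Lemma 7.5 and §7.2.3] [cite: Schwartz1980, Cor. 1] -/
theorem mem_coRP_of_modularZeroTest_height
    (sem : (w : List Bool) → MvPolynomial (Fin (v.eval w.length)) ℤ)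
    (hdeg : ∀ w, (sem w).totalDegree ≤ 2 ^ d.eval w.length)
    (hval : ∀ w (B : ℕ) (a : Fin (v.eval w.length) → ℤ), (∀ i, |a i| < 2 ^ B) →
      (MvPolynomial.eval a (sem w)).natAbs ≤ 2 ^ (2 ^ h.eval w.length * (B + 1)))
    {E : List Bool → List Bool} (hE : E ∈ FP) (hbit : ∀ z, E z = [true] ∨ E z = [false])
    (hspec : ∀ w y, y.length = (coinPolyH v d h).eval w.length →
      (E (boolPair w y) = [true] ↔
        (modOf (KOfH d h w.length) y ≤ 1 ∨
          ((modOf (KOfH d h w.length) y : ℤ) ∣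
            MvPolynomial.eval (ptOf (kOfH d h w.length) (v.eval w.length) (pointSegH d h w.length y)) (sem w))))) :
    ({w | sem w = 0} : Language Bool) ∈ coRP := by
  classical
  set L'' : Language Bool := {z | E z = [true]} with hL''
  have hL''P : L'' ∈ Classes.P :=
    mem_P_of_mem_FP hE L'' fun z => ⟨fun hz => hz, fun hz => (hbit z).resolve_left hz⟩
  have key : PromiseProblem.ofLanguage ({w | sem w = 0} : Language Bool) ∈ PromiseCoRP' := by
    refine mem_PromiseCoRP'_of_weak hL''P (coinPolyH v d h) (gapPolyH d h) (fun w hw y hy => ?_)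
      (fun w hw => ?_)
    · have hw0 : sem w = 0 := hw
      change E (boolPair w y) = [true]
      rw [hspec w y hy]
      exact Or.inr (by rw [hw0, map_zero]; exact dvd_zero _)
    · have hw0 : sem w ≠ 0 := hw
      set n := w.length with hn
      set V := v.eval n
      set k := kOfH d h n
      set K := KOfH d h n
      set Q := sem w
      have hheight : ∀ z : List Bool, (MvPolynomial.eval (ptOf k V z) Q).natAbs ≤ 2 ^ (2 ^ tOfH d h n) := by
        intro z
        have ha : ∀ i, |ptOf k V z i| < 2 ^ k := fun i => by
          rw [abs_of_nonneg (ptOf_nonneg k V z i)]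
          exact ptOf_lt k V z i
        exact (hval w k (ptOf k V z) ha).trans (Nat.pow_le_pow_right (by norm_num) (height_exponent_le' n))
      have hwit := uniformProb_witness_ge (K := K) hw0 hheight
      have hK2 : 2 ≤ K := by simp [KOfH, K]
      have hKpos : (0 : ℝ) < K := by exact_mod_cast (show 0 < K by omega)
      have hprimes := card_primesBelow_two_pow_ge hK2
      have hN1 : (Q.totalDegree : ℝ) / 2 ^ k ≤ 1 / (8 * K) := by
        have h8 : ((8 * KOfH d h n * 2 ^ d.eval n : ℕ) : ℝ) ≤ ((2 ^ kOfH d h n : ℕ) : ℝ) := by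
          exact_mod_cast eight_K_two_pow_d_le' n
        have hdeg' : (Q.totalDegree : ℝ) ≤ ((2 ^ d.eval n : ℕ) : ℝ) := by exact_mod_cast hdeg w
        push_cast at h8 hdeg'
        rw [div_le_div_iff₀ (by positivity) (by positivity)]
        nlinarith
      have hN2 : ((2 ^ tOfH d h n : ℕ) : ℝ) + 2 ≤ 2 ^ K / (8 * K) := by
        have h8 : ((8 * KOfH d h n * (2 ^ tOfH d h n + 2) : ℕ) : ℝ) ≤ ((2 ^ KOfH d h n : ℕ) : ℝ) := by
          exact_mod_cast eight_K_height_le' n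
        push_cast at h8 ⊢
        rw [le_div_iff₀ (by positivity)]
        linarith
      have hgap : (1 : ℝ) / (((gapPolyH d h).eval n : ℕ) + 1) = 1 / (4 * K) := by
        have := eval_gapPolyH_add_one (d := d) (h := h) n
        have h' : (((gapPolyH d h).eval n : ℕ) : ℝ) + 1 = 4 * K := by exact_mod_cast this
        rw [h']
      rw [hn] at hgap ⊢
      rw [hgap]
      have hlen : (coinPolyH v d h).eval w.length = K + V * k := eval_coinPolyH _
      rw [hlen]
      have hmono : uniformProb (K + V * k)
          {y | ¬ (modOf K y ≤ 1 ∨ ((modOf K y : ℤ) ∣ MvPolynomial.eval (ptOf k V (y.drop K)) Q))} ≤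
          uniformProb (K + V * k) {y | boolPair w y ∉ L''} := by
        refine BPExp.uniformProb_mono_len fun y hy hylen => ?_
        change ¬ E (boolPair w y) = [true]
        rw [hspec w y (by rw [hlen]; exact hylen)]
        exact hy
      refine le_trans ?_ (hwit.trans hmono)
      have h2K : (0 : ℝ) < 2 ^ K := by positivity
      have hA : (2 : ℝ) ^ K / (2 * K) - 2 - (2 ^ tOfH d h n : ℕ) ≤
          ((2 ^ K).primesBelow.card : ℝ) - ((2 ^ tOfH d h n : ℕ) : ℝ) := by linarith
      have hB : ((2 : ℝ) ^ K / (2 * K) - 2 - (2 ^ tOfH d h n : ℕ)) / 2 ^ K ≤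
          (((2 ^ K).primesBelow.card : ℝ) - ((2 ^ tOfH d h n : ℕ) : ℝ)) / 2 ^ K :=
        div_le_div_of_nonneg_right hA h2K.le
      have hC : ((2 : ℝ) ^ K / (2 * K) - 2 - (2 ^ tOfH d h n : ℕ)) / 2 ^ K =
          1 / (2 * K) - (((2 ^ tOfH d h n : ℕ) : ℝ) + 2) / 2 ^ K := by
        field_simp
        ring
      have hD : (((2 ^ tOfH d h n : ℕ) : ℝ) + 2) / 2 ^ K ≤ 1 / (8 * K) := by
        rw [div_le_iff₀ h2K]
        calc ((2 ^ tOfH d h n : ℕ) : ℝ) + 2 ≤ 2 ^ K / (8 * K) := hN2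
          _ = 1 / (8 * K) * 2 ^ K := by ring
      have hE' : (1 : ℝ) / (4 * K) = 1 / (2 * K) - 1 / (8 * K) - 1 / (8 * K) := by
        field_simp
        ring
      push_cast at hB hC hD hN1 ⊢
      linarith
  exact ofLanguage_mem_PromiseCoRP'_iff.1 key

/-- **… and hence in `BPP`** (height form). [cite: AroraBarakCC2009, §7.3] -/
theorem mem_BPP_of_modularZeroTest_height
    (sem : (w : List Bool) → MvPolynomial (Fin (v.eval w.length)) ℤ)
    (hdeg : ∀ w, (sem w).totalDegree ≤ 2 ^ d.eval w.length)
    (hval : ∀ w (B : ℕ) (a : Fin (v.eval w.length) → ℤ), (∀ i, |a i| < 2 ^ B) →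
      (MvPolynomial.eval a (sem w)).natAbs ≤ 2 ^ (2 ^ h.eval w.length * (B + 1)))
    {E : List Bool → List Bool} (hE : E ∈ FP) (hbit : ∀ z, E z = [true] ∨ E z = [false])
    (hspec : ∀ w y, y.length = (coinPolyH v d h).eval w.length →
      (E (boolPair w y) = [true] ↔
        (modOf (KOfH d h w.length) y ≤ 1 ∨
          ((modOf (KOfH d h w.length) y : ℤ) ∣
            MvPolynomial.eval (ptOf (kOfH d h w.length) (v.eval w.length) (pointSegH d h w.length y)) (sem w))))) :
    ({w | sem w = 0} : Language Bool) ∈ BPP :=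
  ofLanguage_mem_PromiseBPP'_iff.1 (PromiseCoRP'_subset_PromiseBPP'
    (ofLanguage_mem_PromiseCoRP'_iff.2 (mem_coRP_of_modularZeroTest_height sem hdeg hval hE hbit hspec)))

end Main

end ModularZeroTest

end Literature.Computability.Complexity

end
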